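import Summits.KontsevichZagierPeriods.KontsevichZagierPeriods.Theorems.GpcLegendreLemniscatic.Negative.Canonical
import Summits.KontsevichZagierPeriods.KontsevichZagierPeriods.Theorems.CompleteModGammaSector.Negative.EulerGlue
import Literature.ModelTheory.ExponentialFields.OMinimalEulerInvariance

/-!
# `GpcLegendreLemniscatic` (stmt-KontsevichZagierPeriods-0280) — part 5: additivity is necessary (domain Euler characteristic)

Support file for the crux `Grothendieck.GpcLegendreLemniscatic` (cdisprove seat, gen 1), on top of
part 1 (`Canonical`) and of the Euler-characteristic glue already in the tree
(`Theorems/CompleteModGammaSector/Negative/EulerGlue.lean`: `realEuler n S = eulerChar orderedRing n S`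
over the o-minimal field `ℝ`, `realEuler_band` — a Newton–Leibniz band has the Euler characteristic
of its base, `realEuler_cube`; that file re-proved §8 of this crux's work file
`Cruxes/GpcLegendreLemniscatic/Disproof.lean` and landed first, so it is imported here, not copied).
NEW here: the additive invariant `domainEuler [r] = E(r.domain)` on `FormalRep`; it kills every
Newton–Leibniz move UNCONDITIONALLY (`realEuler_band`) and every change-of-variables move modulo the
named fact `Dries1998_ch4_prop_2_4` (invariance of `E` under injective definable maps, van den Dries
Ch. 4 (2.4), `Literature/ModelTheory/ExponentialFields/OMinimalEulerInvariance.lean`). Since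
`E((0,1)²) − E(ℝ) = 1 − (−1) = 2`, the crux element `[r₀] − [r₀']` is not derivable by rules (2), (3)
alone (`legendre_not_mem_closure_without_additivity`, modulo (2.4)) nor by rule (3) alone
(`legendre_not_mem_closure_newtonLeibniz`, unconditional): an additivity move is necessary. With
part 2 (`legendre_not_mem_closure_without_newtonLeibniz`): every derivation uses rule (1) AND rule
(3). `domainEuler` is a third subcalculus invariant for the summit (after `KZ.coeffSum`,
`KZ.restrictedEval`), the only one separating 2-term elements from `closure(rules 2, 3)`; note it
is NOT an invariant of rule (1b) (integrand additivity gives `−E(σ)`). [cite: Dries1998, Ch. 4 (2.4)]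
-/

noncomputable section

open MeasureTheory Set
open FirstOrder FirstOrder.Language
open Literature.NumberTheory.Transcendental
open Literature.NumberTheory.Transcendental.KZ
open Literature.ModelTheory.ExponentialFields
open Literature.ModelTheory.ExponentialFields.CellDimension
open Summit.KontsevichZagierPeriods.KontsevichZagierPeriods.Theses.Grothendieck (GpcLegendreLemniscatic)
open Summit.KontsevichZagierPeriods.CompleteModGammaSectorNegative (realEuler isOMinimal_real
  definable_univ_of_isSemialgebraic definable_lt_real realEuler_band realEuler_cube)

namespace Summit.KontsevichZagierPeriods.Grothendieck.GpcLegendreLemniscaticNegative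

/-- `E` of the whole line `ℝ¹` is `−1` (the unbounded band cell over `M⁰`). [cite: Dries1998, Ch. 4 (2.1)] -/
theorem realEuler_univ_one : realEuler 1 (univ : Set (Fin 1 → ℝ)) = -1 := by
  have h0 : IsCell Language.orderedRing 0 (fun _ : Fin 0 => true) (univ : Set (Fin 0 → ℝ)) :=
    isCell_zero_iff.mpr rfl
  have hband := h0.band (f := none) (g := none) (by simp) (by simp) (by simp)
  have hset : {v : Fin (0 + 1) → ℝ | (Fin.init v : Fin 0 → ℝ) ∈ (univ : Set (Fin 0 → ℝ)) ∧
      (∀ f' ∈ (none : Option ((Fin 0 → ℝ) → ℝ)), f' (Fin.init v) < v (Fin.last 0)) ∧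
      ∀ g' ∈ (none : Option ((Fin 0 → ℝ) → ℝ)), v (Fin.last 0) < g' (Fin.init v)} = univ := by
    ext v
    simp
  rw [hset] at hband
  have hι : (Fin.snoc (fun _ : Fin 0 => true) true : Fin (0 + 1) → Bool) = fun _ => true := by
    funext i
    rw [Fin.fin_one_eq_zero i]
    rfl
  rw [hι] at hband
  rw [realEuler, eulerChar_cell isOMinimal_real definable_lt_real hband,
    dim_eq_typeDim isOMinimal_real definable_lt_real hband, typeDim_const_true]
  norm_num

/-- **`E((0,1)²) = 1`** for the domain of `r₀` (tree `realEuler_cube`). [cite: Dries1998, Ch. 4 (2.11)] -/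
theorem realEuler_legendreRep_domain : realEuler 2 legendreRep.domain = 1 := by
  rw [legendreRep_domain]
  have h : realEuler 2 unitSq = (-1) ^ 2 := realEuler_cube 2
  rw [h]
  norm_num

/-- **`E(ℝ) = −1`** for the domain of `r₀'`. [cite: Dries1998, Ch. 4 (2.1)] -/
theorem realEuler_arctanRep_domain : realEuler 1 arctanRep.domain = -1 := realEuler_univ_one

/-- **The domain Euler characteristic**: the additive extension of `[r] ↦ E(r.domain)` to formal
combinations of integral representations. [cite: Dries1998, Ch. 4 (2.3)] -/
def domainEuler : FormalRep →+ ℤ := FreeAbelianGroup.lift fun p => realEuler p.1 p.2.domain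

/-- `domainEuler` of a generator. [cite: Dries1998, Ch. 4 (2.3)] -/
@[simp] theorem domainEuler_of {n : ℕ} (r : IntegralRep n) : domainEuler (of r) = realEuler n r.domain :=
  FreeAbelianGroup.lift_apply_of _ _

/-- **A Newton–Leibniz move preserves `E` of the domain** (unconditionally): the band over `τ`
with closed bounded fibres `[a x, b x]` has `E = E(τ)` (tree `realEuler_band`, fibre formula).
[cite: Dries1998, Ch. 4 (2.11)] -/
theorem domainEuler_eq_zero_of_mem_newtonLeibnizRel {c : FormalRep} (hc : c ∈ newtonLeibnizRel) :
    domainEuler c = 0 := by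
  obtain ⟨n, r, r', a, b, F, -, -, -, hab, hdom, -, -, -, rfl⟩ := hc
  rw [map_sub, domainEuler_of, domainEuler_of, sub_eq_zero]
  exact realEuler_band r r' hab hdom

/-- **A change-of-variables move preserves `E` of the domain**, modulo van den Dries (2.4)
(`Dries1998_ch4_prop_2_4`, a named fact of the tree; the graph over the domain of the move's map is
`ℚ`-semialgebraic by the move's first hypothesis, hence definable). [cite: Dries1998, Ch. 4 (2.4)] -/
theorem domainEuler_eq_zero_of_mem_changeOfVariablesRel
    (hE : Dries1998_ch4_prop_2_4 Language.orderedRing ℝ) {c : FormalRep}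
    (hc : c ∈ changeOfVariablesRel) : domainEuler c = 0 := by
  obtain ⟨n, r, r', Φ, Φ', h1, -, h3, h4, -, rfl⟩ := hc
  rw [map_sub, domainEuler_of, domainEuler_of, sub_eq_zero, realEuler, realEuler, h4]
  exact (hE isOMinimal_real definable_lt_real r.domain Φ (definable_univ_of_isSemialgebraic h1) h3).symm

/-- **Rules (2) + (3) preserve `E` of the domain** (modulo (2.4)). [cite: Dries1998, Ch. 4 (2.4)] -/
theorem closure_cov_nl_le_ker_domainEuler (hE : Dries1998_ch4_prop_2_4 Language.orderedRing ℝ) :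
    AddSubgroup.closure (changeOfVariablesRel ∪ newtonLeibnizRel) ≤ domainEuler.ker := by
  refine (AddSubgroup.closure_le _).mpr ?_
  rintro c (hc | hc)
  · exact domainEuler_eq_zero_of_mem_changeOfVariablesRel hE hc
  · exact domainEuler_eq_zero_of_mem_newtonLeibnizRel hc

/-- `domainEuler ([r₀] − [r₀']) = E((0,1)²) − E(ℝ) = 1 − (−1) = 2`. [cite: Dries1998, Ch. 4 (2.1)] -/
theorem domainEuler_legendre : domainEuler (of legendreRep - of arctanRep) = 2 := by
  rw [map_sub, domainEuler_of, domainEuler_of, realEuler_legendreRep_domain, realEuler_arctanRep_domain]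
  norm_num

/-- **ADDITIVITY IS NECESSARY (modulo van den Dries (2.4))**: `[r₀] − [r₀']` is NOT in the
subgroup generated by the change-of-variables and Newton–Leibniz moves alone; every derivation of
the crux uses an additivity move (1a)/(1b). With `legendre_not_mem_closure_without_newtonLeibniz`
(part 2): every derivation uses rule (1) AND rule (3). [cite: Dries1998, Ch. 4 (2.4)] -/
theorem legendre_not_mem_closure_without_additivity (hE : Dries1998_ch4_prop_2_4 Language.orderedRing ℝ) :
    of legendreRep - of arctanRep ∉ AddSubgroup.closure (changeOfVariablesRel ∪ newtonLeibnizRel) := by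
  intro h
  have h0 := closure_cov_nl_le_ker_domainEuler hE h
  rw [AddMonoidHom.mem_ker, domainEuler_legendre] at h0
  norm_num at h0

/-- Unconditionally: Newton–Leibniz moves ALONE do not derive the crux (they preserve `E` of the
domain). [cite: Dries1998, Ch. 4 (2.11)] -/
theorem legendre_not_mem_closure_newtonLeibniz :
    of legendreRep - of arctanRep ∉ AddSubgroup.closure newtonLeibnizRel := by
  intro h
  have hle : AddSubgroup.closure newtonLeibnizRel ≤ domainEuler.ker :=
    (AddSubgroup.closure_le _).mpr fun c hc => domainEuler_eq_zero_of_mem_newtonLeibnizRel hc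
  have h0 := hle h
  rw [AddMonoidHom.mem_ker, domainEuler_legendre] at h0
  norm_num at h0

end Summit.KontsevichZagierPeriods.Grothendieck.GpcLegendreLemniscaticNegative
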